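import Summits.CriticalPhenomena.PercolationContinuityZ3.Theorems.PercNearOneGluingNoHeavyQuantPeierlsStarDriver
import Summits.CriticalPhenomena.PercolationContinuityZ3.Theorems.PercNearOneGluingNoHeavyQuantSlabPercOfTargetSchema
import HarnessLib

/-!
# QUANT lane / PAPER-2 rate track (ARM-1, gen 2), Peierls lever P4: the effective Kozma–Nitzan criterion with the Peierls constant
# as a PARAMETER `ε ≤ 2⁻⁸`

builds on p205010 (kernel theorem, internal audit signed; external expert review pending)

Cell `prim-quant`, seat `prim-quant-arm-1` (rate-theorem architect), memo `run/shared/lean/prim/quant/RATE-PLAN.md` §11.  The tree's criteria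
`Quant.slabPerc_of_finiteSizeInputs` (p208543) and `Quant.slabPerc_of_thinTargetLemma` (p240627, F1) HARD-WIRE the Peierls budget `ε = 2⁻³²` of the
exploration driver in their tolerance ties `(1−δ₂)^K + ε/8 ≤ ε/4` and `δc + 6dδq + 6δe ≤ ε/8` (postcont QUANT §46 (5), ARM-REF-G6 §5: "only a
re-parametrised F1 can quote the §5 levers").  With the vertex-Peierls driver of P2 (`StarPeierls.theta_slab_pos_star`, threshold `2⁻⁸`) the same
assemblies go through for EVERY `0 < ε ≤ 2⁻⁸`:

* `Quant.slabPerc_of_thinTargetLemma_eps` — F1 verbatim with `ε` a parameter (the schema `htl` with a FREE margin function `Rof`);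
* `Quant.slabPerc_of_finiteSizeInputs_eps` — the Kozma–Nitzan instance (`thinTargetLemma_kn`), i.e. p208543 verbatim with `ε` a parameter.

At `ε = 2⁻³²` these are the tree theorems; at `ε = 2⁻⁸` every tolerance of the cascade grows (`δc = ε/16`, `δ = ε/192`, `K ≈ 32 ln(8/ε)/ε`,
`τ_U = δ_E²/2`, `η = τ_U^{d·2^d}`) and the printed `d = 3` base `1 − 2⁻⁶²⁸⁴` becomes `≈ 1 − 2⁻²⁷⁵⁰` once the `kn`-cascade is re-run (P5).  Class of the
rate (iterated logarithm) and the honest sentence are UNCHANGED.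
[cite: KozmaNitzan2024, §4 Theorem 6 (pp. 25–31), Lemmas 10–12]
-/

noncomputable section

namespace Summit.CriticalPhenomena.PercolationContinuityZ3.Theorems.Quant

open MeasureTheory Literature.Probability.LatticeModels Literature.Probability.Percolation
  Literature.Probability.Percolation.KozmaNitzan
open Literature.Probability.Percolation.GadgetSystem Literature.Probability.Percolation.Contour

variable {d : ℕ}

/-- **Kozma–Nitzan's Theorem 6, effective, from the thin target-lemma schema, Peierls constant `ε ∈ (0, 2⁻⁸]` as a parameter.**
Exactly `Quant.slabPerc_of_thinTargetLemma` (p240627) with `2⁻³²` replaced by `ε` in the two tolerance ties `(1−δ₂)^K + ε/8 ≤ ε/4` and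
`δc + 6dδq + 6δe ≤ ε/8`, the scheme's lawfulness closed by the `2⁻⁸`-driver `StarPeierls.theta_slab_pos_star`.
builds on p205010 (kernel theorem, internal audit signed; external expert review pending).
[cite: KozmaNitzan2024, §4 Theorem 6 (pp. 25–31), Lemmas 10–12] -/
theorem slabPerc_of_thinTargetLemma_eps (hd : 3 ≤ d) (p : unitInterval) (hp0 : 0 < (p : ℝ))
    {ε : ℝ} (hε0 : 0 < ε) (hε : ε ≤ (1 / 2 : ℝ) ^ 8)
    {K : ℕ} (hK20 : 20 ≤ K)
    {δ₂ δc δt δtq δq δe δeq δ6q δmin τ : ℝ}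
    (hδ₂1 : δ₂ ≤ 1) (hδc1 : δc ≤ 1)
    (hKε : (1 - δ₂) ^ K + ε / 8 ≤ ε / 4)
    (hct : δ₂ + 6 * δt ≤ δc)
    (h12 : δc + (d : ℝ) * (6 * δq) + 6 * δe ≤ ε / 8)
    (htq : τ + ((8 * (2 * K) - 4 : ℕ) : ℝ) * (6 * δtq) ≤ δt ^ 2)
    (heq : τ + ((8 * 88 - 4 : ℕ) : ℝ) * (6 * δeq) ≤ δe ^ 2)
    (h6q : τ + ((8 * 6 - 4 : ℕ) : ℝ) * (6 * δ6q) ≤ δc)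
    (hδmin0 : 0 < δmin) (hmin_t : δmin ≤ δt) (hmin_tq : δmin ≤ δtq) (hmin_q : δmin ≤ δq)
    (hmin_e : δmin ≤ δe) (hmin_eq : δmin ≤ δeq) (hmin_6q : δmin ≤ δ6q)
    (hτ : τ < δmin ^ 2)
    {n M R₀ R₁ s : ℕ} {Rof : ℕ → ℕ} (hnM : n < M) (hMR₀ : M ≤ R₀) (hR₀ : Rof M ≤ R₀)
    (hR₁a : Rof (8 * (3 * (2 * K) + 3 * (2 * K) * R₀ + n + M + 8)) ≤ R₁)
    (hR₁b : Rof (8 * (3 * 88 + 3 * 88 * R₀ + n + M + 8)) ≤ R₁)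
    (hs1 : 1 ≤ s) (hsR : 2 * R₁ ≤ s) (hs12 : 100 * (d + 1) * (max R₀ R₁ + 1) ≤ s)
    (hs6 : 8 * (3 * 6 + 3 * 6 * R₀ + n + M + 8) ≤ 3 * (K * s)) (hn3 : n ≤ 3 * (K * s))
    (htl : ∀ δx : ℝ, δmin ≤ δx → ∀ H : List (Geom d),
      (∀ g ∈ H, g.loQ ≤ g.hiQ ∧ ∀ a : Fin d, ∃ i : Fin d, i ≠ a ∧ g.loQ i + 2 ≤ g.hiQ i) →
      ∀ ℓmax R : ℕ, Rof ℓmax ≤ R →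
      (∀ g ∈ H, ∀ ℓ : ℕ, ℓmax ≤ ℓ → ℓ ≤ 5 * (K * s) →
        1 - δx ^ 2 < (bondPercolation (zdGraph d) p).real (linkIn (↑(g.Qset ℓ 0)) (box d n) (g.Fset ℓ 0))) →
      ∀ δ' : ℝ, TargetPropertyThinAt d p (δ' + 6 * δx) δ' H R (5 * (K * s)))
    (hface : ∀ n' : ℕ, M ≤ n' → n' ≤ 5 * (K * s) → ∀ (a : Fin d) (τ' : Fin d → ℤˣ),
      1 - τ < (bondPercolation (zdGraph d) p).real (linkEvent (box d n) (orthantFace a τ' n') n'))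
    (hqf : ∀ g ∈ qfList d, ∀ ℓ : ℕ, M ≤ ℓ → ℓ ≤ 5 * (K * s) →
      1 - τ < (bondPercolation (zdGraph d) p).real (linkIn (↑(g.Qset ℓ 0)) (box d n) (g.Fset ℓ 0))) :
    ∃ S : KSch d, S.p = p ∧ S.C.K = K ∧ S.C.s = s ∧ S.δc = δc ∧
      0 < theta ((zdGraph d).induce S.slab) ⟨0, S.zero_mem_slab⟩ p := by
  classical
  haveI : NeZero d := ⟨by omega⟩
  set W : ℕ := 5 * (K * s) with hW
  -- tolerance bookkeeping
  have hsq : ∀ δx : ℝ, δmin ≤ δx → τ < δx ^ 2 := fun δx hx =>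
    hτ.trans_le (pow_le_pow_left₀ hδmin0.le hx 2)
  -- arithmetic on the scales
  have hMs : M ≤ s := by
    have : max R₀ R₁ + 1 ≤ 100 * (d + 1) * (max R₀ R₁ + 1) := Nat.le_mul_of_pos_left _ (by positivity)
    have : R₀ ≤ max R₀ R₁ := le_max_left _ _
    omega
  have hsKs : s ≤ K * s := Nat.le_mul_of_pos_left s (by omega)
  have hMW : M ≤ W := by rw [hW]; nlinarith
  -- (1) the quarter-face families (schema at `ℓmax = M`, margin `R₀`)
  have famQ : ∀ δx : ℝ, δmin ≤ δx → ∀ δ' : ℝ, TargetPropertyThinAt d p (δ' + 6 * δx) δ' (qfList d) R₀ W := by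
    intro δx hx δ'
    have hτx := hsq δx hx
    refine htl δx hx (qfList d) (wideList_qfList (by omega)) M R₀ hR₀ (fun g hg ℓ h1 h2 => ?_) δ'
    exact lt_of_le_of_lt (by linarith) (hqf g hg ℓ h1 h2)
  -- (2) elongated boxes are hit (Lemma 11, linear) for aspects `K' ≥ 2`, from the family at tolerance `δx`
  have hitE : ∀ (K' : ℕ) (hK' : 2 ≤ K') (δx : ℝ), δmin ≤ δx → ∀ {r' m' : ℕ},
      8 * (3 * K' + 3 * K' * R₀ + n + M + 8) ≤ r' → r' ≤ W → n ≤ m' → ∀ (a : Fin d) (σ : ℤˣ),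
      1 - (τ + ((8 * K' - 4 : ℕ) : ℝ) * (6 * δx)) < (bondPercolation (zdGraph d) p).real
        (linkIn (↑((elongGeom a σ K' (by omega)).Qset r' 0)) (box d m')
          ((elongGeom a σ K' (by omega)).Fset r' 0)) := by
    intro K' hK' δx hx r' m' hr hrW hm a σ
    exact elongHit_thin p (famQ δx hx) a σ K' hK' (k := n) (n₁ := M) (r := r') (m := m') hrW
      (fun n' h1 h2 a' τ' => hface n' h1 (h2.trans hrW) a' τ') hr hm
  -- (3) the elongated families of aspects `2K` (tolerance `δt`) and `88` (tolerance `δe`), margin `R₁`, from the schema with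
  -- Lemma 11 as the hittability input
  have hK2 : 2 ≤ 2 * K := by omega
  have famT : ∀ δ' : ℝ, TargetPropertyThinAt d p (δ' + 6 * δt) δ' (elongList d (2 * K) (by omega)) R₁ W := by
    intro δ'
    have hτt := hsq δt hmin_t
    refine htl δt hmin_t _ (wideList_elongList hd _ _)
      (8 * (3 * (2 * K) + 3 * (2 * K) * R₀ + n + M + 8)) R₁ hR₁a (fun g hg ℓ h1 h2 => ?_) δ'
    rw [elongList, List.mem_map] at hg
    obtain ⟨x, -, rfl⟩ := hg
    exact lt_of_le_of_lt (by linarith) (hitE (2 * K) hK2 δtq hmin_tq h1 h2 le_rfl x.1 x.2)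
  have famE : ∀ δ' : ℝ, TargetPropertyThinAt d p (δ' + 6 * δe) δ' (elongList d 88 (by norm_num)) R₁ W := by
    intro δ'
    have hτe := hsq δe hmin_e
    refine htl δe hmin_e _ (wideList_elongList hd _ _)
      (8 * (3 * 88 + 3 * 88 * R₀ + n + M + 8)) R₁ hR₁b (fun g hg ℓ h1 h2 => ?_) δ'
    rw [elongList, List.mem_map] at hg
    obtain ⟨x, -, rfl⟩ := hg
    exact lt_of_le_of_lt (by linarith) (hitE 88 (by norm_num) δeq hmin_eq h1 h2 le_rfl x.1 x.2)
  -- (4) the scheme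
  set C : Cells d := ⟨hd, K, s, hK20, hs1⟩ with hCdef
  set S : KSch d := ⟨C, p, δc⟩ with hSdef
  refine ⟨S, rfl, rfl, rfl, rfl, ?_⟩
  have hCr : C.r = K * s := rfl
  have hL : S.scheme.Lawful (zdGraph d) p ε := by
    refine S.lawful (fun du => ?_) (fun h e hV => ?_)
    · -- (32) at the origin: the aspect-6 box is hit from `Λ_{3r}` at scale `3r`
      refine S.hQ0_of_hit du (lt_of_le_of_lt ?_
        (hitE 6 (by norm_num) δ6q hmin_6q (r' := 3 * C.r) (m' := 3 * C.r) ?_ ?_ ?_ (C.axOf du) (σu du)))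
      · show 1 - δc ≤ 1 - (τ + ((8 * 6 - 4 : ℕ) : ℝ) * (6 * δ6q)); linarith
      · rw [hCr]; exact hs6
      · rw [hCr, hW]; omega
      · rw [hCr]; exact hn3
    · refine fail_bound_thin hV hε0.le hδ₂1 (R := R₁) (fun T hT hTr hyp => ?_) ?_ hsR hKε
      · -- Lemma 12, linear, in the weighting of the corridor datum `T` (`T.r = C.r = Ks`)
        have hTr' : T.r = K * s := by rw [hTr]; rfl
        have hc := corridorLemma_thin p (famQ δq hmin_q) famE T hT (wth := W) (by rw [hTr', hW])
          (by rw [hTr']; exact le_trans hs12 hsKs) (δ' := δc) hyp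
        refine lt_of_le_of_lt ?_ hc
        show 1 - ε / 8 ≤ 1 - (δc + (d : ℝ) * (6 * δq) + 6 * δe)
        linarith
      · -- the target lemma for the aspect-`2K` boxes, thin, at (`δc`, `δ₂`)
        show TargetPropertyThinAt d p δc δ₂ (elongList d (2 * K) _) R₁ (5 * (K * s))
        exact (famT δ₂).mono_eps hct
  exact StarPeierls.theta_slab_pos_star S hL hε hp0 hδc1

/-- **Kozma–Nitzan's Theorem 6, EFFECTIVE, Peierls constant `ε ∈ (0, 2⁻⁸]` as a parameter** — `Quant.slabPerc_of_finiteSizeInputs` (p208543)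
verbatim with `2⁻³²` replaced by `ε`: slab percolation at `p` from (U) the uniqueness zone, (F) orthant faces and (Q) quarter-face hits on the
bounded range `[M, 5Ks]`, Kozma–Nitzan's seeds `k` and margins `R₀, R₁` (the schema instance `thinTargetLemma_kn`).
builds on p205010 (kernel theorem, internal audit signed; external expert review pending).
[cite: KozmaNitzan2024, §4 Theorem 6 (pp. 25–31), Lemmas 10–12] -/
theorem slabPerc_of_finiteSizeInputs_eps (hd : 3 ≤ d) (p : unitInterval) (hp0 : 0 < (p : ℝ)) (hp1 : (p : ℝ) < 1)
    {ε : ℝ} (hε0 : 0 < ε) (hε : ε ≤ (1 / 2 : ℝ) ^ 8)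
    {K : ℕ} (hK20 : 20 ≤ K)
    {δ₂ δc δt δtq δq δe δeq δ6q δmin τ : ℝ}
    (hδ₂1 : δ₂ ≤ 1) (hδc1 : δc ≤ 1)
    (hKε : (1 - δ₂) ^ K + ε / 8 ≤ ε / 4)
    (hct : δ₂ + 6 * δt ≤ δc)
    (h12 : δc + (d : ℝ) * (6 * δq) + 6 * δe ≤ ε / 8)
    (htq : τ + ((8 * (2 * K) - 4 : ℕ) : ℝ) * (6 * δtq) ≤ δt ^ 2)
    (heq : τ + ((8 * 88 - 4 : ℕ) : ℝ) * (6 * δeq) ≤ δe ^ 2)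
    (h6q : τ + ((8 * 6 - 4 : ℕ) : ℝ) * (6 * δ6q) ≤ δc)
    (hδmin0 : 0 < δmin) (hmin_t : δmin ≤ δt) (hmin_tq : δmin ≤ δtq) (hmin_q : δmin ≤ δq)
    (hmin_e : δmin ≤ δe) (hmin_eq : δmin ≤ δeq) (hmin_6q : δmin ≤ δ6q)
    (hτ : τ < δmin ^ 2)
    {n M k R₀ R₁ s : ℕ} (hnM : n < M)
    (hk : (1 - (p : ℝ) ^ seedBound d M) ^ k ≤ δmin)
    (hR₀ : 3 * M + M + 4 + ⌈(1 / (1 - (p : ℝ)) ^ (2 * d * LData.Ncont d M k)) / δmin⌉₊ ≤ R₀)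
    (hR₁a : 3 * M + 8 * (3 * (2 * K) + 3 * (2 * K) * R₀ + n + M + 8) + 4 +
      ⌈(1 / (1 - (p : ℝ)) ^ (2 * d * LData.Ncont d M k)) / δmin⌉₊ ≤ R₁)
    (hR₁b : 3 * M + 8 * (3 * 88 + 3 * 88 * R₀ + n + M + 8) + 4 +
      ⌈(1 / (1 - (p : ℝ)) ^ (2 * d * LData.Ncont d M k)) / δmin⌉₊ ≤ R₁)
    (hs1 : 1 ≤ s) (hsR : 2 * R₁ ≤ s) (hs12 : 100 * (d + 1) * (max R₀ R₁ + 1) ≤ s)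
    (hs6 : 8 * (3 * 6 + 3 * 6 * R₀ + n + M + 8) ≤ 3 * (K * s)) (hn3 : n ≤ 3 * (K * s))
    (huniq : 1 - τ < (bondPercolation (zdGraph d) p).real (uniqZone n M))
    (hface : ∀ n' : ℕ, M ≤ n' → n' ≤ 5 * (K * s) → ∀ (a : Fin d) (τ' : Fin d → ℤˣ),
      1 - τ < (bondPercolation (zdGraph d) p).real (linkEvent (box d n) (orthantFace a τ' n') n'))
    (hqf : ∀ g ∈ qfList d, ∀ ℓ : ℕ, M ≤ ℓ → ℓ ≤ 5 * (K * s) →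
      1 - τ < (bondPercolation (zdGraph d) p).real (linkIn (↑(g.Qset ℓ 0)) (box d n) (g.Fset ℓ 0))) :
    ∃ S : KSch d, S.p = p ∧ S.C.K = K ∧ S.C.s = s ∧ S.δc = δc ∧
      0 < theta ((zdGraph d).induce S.slab) ⟨0, S.zero_mem_slab⟩ p := by
  haveI : NeZero d := ⟨by omega⟩
  have hMW : M ≤ 5 * (K * s) := by
    have : max R₀ R₁ + 1 ≤ 100 * (d + 1) * (max R₀ R₁ + 1) := Nat.le_mul_of_pos_left _ (by positivity)
    have : R₀ ≤ max R₀ R₁ := le_max_left _ _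
    have hsKs : s ≤ K * s := Nat.le_mul_of_pos_left s (by omega)
    omega
  exact slabPerc_of_thinTargetLemma_eps hd p hp0 hε0 hε hK20 hδ₂1 hδc1 hKε hct h12 htq heq h6q hδmin0 hmin_t hmin_tq hmin_q
    hmin_e hmin_eq hmin_6q hτ (Rof := fun ℓmax => 3 * M + ℓmax + 4 +
      ⌈(1 / (1 - (p : ℝ)) ^ (2 * d * LData.Ncont d M k)) / δmin⌉₊) hnM (by omega) hR₀ hR₁a hR₁b hs1 hsR hs12 hs6 hn3
    (thinTargetLemma_kn p hp1 hδmin0 hτ hnM (fun a τ' => hface M le_rfl hMW a τ') huniq hk) hface hqf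

end Summit.CriticalPhenomena.PercolationContinuityZ3.Theorems.Quant

end
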